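import Summits.BirchSwinnertonDyer.BirchSwinnertonDyer.Theorems.ByReductionTypeAtTwoFineSelmerConjAAtTwoAdditivePotGoodClassNumberOne780
import Summits.BirchSwinnertonDyer.BirchSwinnertonDyer.Theorems.ByReductionTypeAtTwoFineSelmerConjAAtTwoAdditivePotGoodTwoLayerDoorFukudaRows
import Summits.BirchSwinnertonDyer.BirchSwinnertonDyer.Theorems.ByReductionTypeAtTwoFineSelmerConjAAtTwoAdditivePotGoodTwoLayerStampsEvenIndexA
import Summits.BirchSwinnertonDyer.BirchSwinnertonDyer.Theorems.ByReductionTypeAtTwoFineSelmerConjAAtTwoAdditivePotGoodTwoLayerStampsEvenIndexC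
import Summits.BirchSwinnertonDyer.BirchSwinnertonDyer.Theorems.ByReductionTypeAtTwoOrdKatoHalfAtTwoIsoConjATwoCubicModelOfClassicalMu
import Summits.BirchSwinnertonDyer.BirchSwinnertonDyer.Theorems.ByReductionTypeAtTwoOrdKatoHalfAtTwoIsoConjATwoOfNarrowRankCertificate
import HarnessLib

/-!
# K4 crux `AdditiveRankZeroAtTwo` (19098), child C3″ `AdditivePotGoodLowerHalfAtTwo` (item 22617): the TWO-PRIME `Δ_cubic > 0` rows — (A)₂ and the BSD₂ rungs with the
# print binder `hLim2` (LIM35@2-REAL) REPLACED by a NARROW RANK CERTIFICATE of the totally real cubic point field (census instance: ONE equality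
# `rank₂ Cl⁺(ℚ(θ)·ℚ₁) = rank₂ Cl⁺(ℚ(θ))`; file A of the `NarrowRankRows` series A–C; seat `bsd-2adic-k4-w2` GEN 11; `--supports stmt-BirchSwinnertonDyer-22617 --as helper`)

Cell `bsd-2adic`. After k4-w1 GEN 9's `conjA_two_100560c1''` (one prime above `2`: Horie–Fukuda unit-signature road, kernel) six `Δ_cubic > 0` rows of the C1″ census
still carried GEN 8's print binder `hLim2` = Lim 2017 Thm. 3.5 at `2` DOWNSTAIRS at a TOTALLY REAL carrier (the RC-457 D-audit risk `LIM35@2-REAL`): `261648q1`,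
`279440c1`, `293200be1`, `412992bw1`, `445508b1`, `467928d1` — all with TWO primes above `2` in the cubic field `ℚ(θ)` (`h(ℚ(θ)) = 1`), outside the one-prime doors.
cruxlead-19573-w2 GEN 9 landed NARROW FUKUDA (Literature p739601 `NarrowFukudaRankProofs`, p739895 `NarrowFukudaCertificateLayerModels`: Fukuda 1994 Thm. 1 (2) for
NARROW class groups, finite level) and the door `NarrowRankCert.conjA_two_cubicModel_of_narrowRankCertificate` (`…OrdKatoHalfAtTwoIsoConjATwoOfNarrowRankCertificate`, ANY
sign of `Δ`): Fukuda index `n₀` on the cubic tower ∧ `[Cl⁺(layer n₀+1) : (Cl⁺)²] = [Cl⁺(layer n₀) : (Cl⁺)²]` ∧ narrow ranks bounded below layer `n₀` ⟹ narrow `μ₂ = 0` and a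
narrow-defect bound ⟹ (A)₂ by GEN 8's Kida-lite ascent `NarrowMu.conjA_two_cubicModel_of_narrowMu`. This file supplies, per row (rows `261648q1`, `279440c1`): §1 the KERNEL
`n₀ = 0` on `ℚ(θ)` (`forall_totallyRamifiedFrom_zero_h<L>`: even-index certificates in `ℤ[θ]` for `316` and `9980`), the general stamp `AddKatoTwo.conjA_two_<L>_of_narrowRankCert hθ n B hcert` (exact change
`θ ↔ x(P)`; any layer pair `n / n+1`) and the CENSUS INSTANCE `AddKatoTwo.conjA_two_<L>_of_narrowRankEq₀₁ hθ hnr` — (A)₂ with NO print fact from ONE displayed equality of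
narrow `2`-ranks at layers `0 / 1` (= equality of the unit-signature defects `#(U⁺/U²)` of `ℚ(θ, √2)` and `ℚ(θ)`, both class numbers being odd); §2 GEN 3's rungs
re-keyed: `AddPotGoodInstances.bsdp_two_<L>_narrowRankEq`, `bsdp_two_of_isIsogenous_<L>_narrowRankEq` — BSD₂ on the class ⟸ PRINT {hSharp (reading), hGZK, hmod, hCT(,
hCassels)} + RECORD {r_an = 0, #Ш_an = q, ord₂ q ≤ 6} + the two VALUED Selmer slots + `hnr`; `hLim2` GONE. `θ` is k4-w1's generator (`…ChevalleyStamps{A,B,C}`).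

HONEST FRAMING (D-0036 / D-0054 / D-0152): conditional theorems; `hnr` is an INSTRUMENT-tier datum that is **UNVALUED** when this file lands (the cell holds no
`bnfnarrow` record for these six cubic fields and their `√2`-layers; ≈ one core-minute of PARI owed — WANTED posted on STATUS; if the layer-`0/1` narrow ranks differ,
the general stamp takes a higher layer pair); `hSharp` is the Kato-at-`2` SHARP reading (D-audit PASS). Closes nothing at the `∀`-level (C3″ 22617 / C1″ 22615 OPEN);
nothing booked (D-0054); no rung moves; BSD is not proved by any of this. THEOREMS ONLY (no `def`).

References: [Fukuda1994] Thm. 1 (2), p. 264; [Washington1997] §13.1 Prop. 13.2, Lemma 13.3; [Kida1982JFields] main theorem (shape); [CoatesSujatha2005] (A), Thm. 3.4;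
[Kato2004Asterisque] Thm. 12.5 (1)(3), 13.8, 14.14; [Cassels1965ArithmeticVIII] Thm. 1.3; [Miller2011LMS] Def. 1.1.
-/

set_option autoImplicit false
-- the Theorems namespace of this sub repeats the summit name by design (D-0017 nested layout)
set_option linter.dupNamespace false

noncomputable section

open scoped Classical IntermediateField NumberField Real nonZeroDivisors

/-! ## Kernel `n₀ = 0` and narrow-rank stamps (namespace `AddKatoTwo`); the rungs are in `…NarrowRankRungsA` -/

namespace Summit.BirchSwinnertonDyer.BirchSwinnertonDyer.Theorems.AddKatoTwo

open WeierstrassCurve Field Polynomial IsDedekindDomain NumberField Matrix Literature.NumberTheory.EllipticCurves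
  Literature.NumberTheory.GaloisRepresentations
  Literature.NumberTheory.IwasawaTheory
  Literature.NumberTheory.NumberFields
  Summit.BirchSwinnertonDyer.BirchSwinnertonDyer.Theorems.SteinbergFibreAtTwo
  Summit.BirchSwinnertonDyer.BirchSwinnertonDyer.Theorems.AlignedTransportAtTwoTorsionPointField
  Summit.BirchSwinnertonDyer.BirchSwinnertonDyer.Theses.ByReductionTypeAtTwo

/-- **A monic integer cubic with a root `β` of degree `3` is irreducible** (restated to keep this file's imports minimal). [folklore] -/
private theorem irreducibleCubic_of_finrank_three_srnrA {p q r : ℤ} {β : AlgebraicClosure ℚ}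
    (hβ : aeval β (Cubic.toPoly ⟨1, (p : ℚ), q, r⟩) = 0) (h3 : Module.finrank ℚ (IntermediateField.adjoin ℚ {β}) = 3) :
    Irreducible (Cubic.toPoly ⟨1, (p : ℚ), q, r⟩) := by
  have hfm : (Cubic.toPoly ⟨1, (p : ℚ), q, r⟩).Monic := Cubic.monic_of_a_eq_one'
  have hβint : IsIntegral ℚ β := ⟨_, hfm, by rwa [← aeval_def]⟩
  have hdeg : (minpoly ℚ β).natDegree = (Cubic.toPoly ⟨1, (p : ℚ), q, r⟩).natDegree := by
    rw [← IntermediateField.adjoin.finrank hβint, h3, Cubic.natDegree_of_a_ne_zero' one_ne_zero]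
  have heq : Cubic.toPoly ⟨1, (p : ℚ), q, r⟩ = minpoly ℚ β :=
    Polynomial.eq_of_monic_of_dvd_of_natDegree_le (minpoly.monic hβint) hfm (minpoly.dvd ℚ β hβ) hdeg.ge
  rw [heq]
  exact minpoly.irreducible hβint

/-- **The displayed part of the `n₀ = 0` narrow rank certificate from ONE layer-`0/1` equality, for any number field `K`** (file-private helper; the bound at layer `0` is
`ord₂ [Cl⁺(K) : (Cl⁺)²]` itself by `index_range_pow_narrowClassGroup_layer_zero_eq`). Stated for a generic `K` on purpose: at the concrete point fields
`ℚ(θ) ⊂ ℚ̄` the same `rw` exhausts the `isDefEq` budget. [cite: Fukuda1994, Thm. 1 (2), p. 264] -/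
private theorem narrowRankCert_zero_of_layerEq_A (K : Type) [Field K] [NumberField K]
    (hnr : ∀ κ : ZpExtension K 2, κ.IsCyclotomic →
      ∀ [NumberField ↥(κ.layer 0)] [NumberField ↥(κ.layer 1)],
        (powMonoidHom (α := NarrowClassGroup ↥(κ.layer 1)) 2).range.index =
          (powMonoidHom (α := NarrowClassGroup ↥(κ.layer 0)) 2).range.index) :
    ∀ κ : ZpExtension K 2, κ.IsCyclotomic →
      (∀ [NumberField ↥(κ.layer 0)] [NumberField ↥(κ.layer (0 + 1))],
        (powMonoidHom (α := NarrowClassGroup ↥(κ.layer (0 + 1))) 2).range.index =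
          (powMonoidHom (α := NarrowClassGroup ↥(κ.layer 0)) 2).range.index) ∧
      (∀ m : ℕ, m ≤ 0 → ∀ [NumberField ↥(κ.layer m)],
        padicValNat 2 (powMonoidHom (α := NarrowClassGroup ↥(κ.layer m)) 2).range.index ≤
          padicValNat 2 (powMonoidHom (α := NarrowClassGroup K) 2).range.index) := by
  intro κ hκ
  refine ⟨?_, ?_⟩
  · intro i0 i1
    exact @hnr κ hκ i0 i1
  · intro m hm i
    obtain rfl : m = 0 := Nat.le_zero.mp hm
    rw [index_range_pow_narrowClassGroup_layer_zero_eq κ 2]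

/-- **`n₀ = 0` for `ℚ(θ)` of `261648q1`, KERNEL, by an EVEN-INDEX CERTIFICATE** (k4-w1 p689647 `totallyRamifiedFrom_zero_of_evenIndexCertificate`):
`u = [-2, 2, 0]`, `v = [-2, -1, 1]`, `m = [-2, -1, 1]`, `m' = [3, -1, 0]` (coordinates in `ℤ[θ]`, index `1` — `2`-maximal) satisfy `u² − 2v² = 4m`, `m² = 2m'`
and `N(2 − m'³) = 2666` (`ord₂ = 1`, so `8 ∤`) — exact search (seat tools), verified as ring identities + one companion determinant.
[cite: Fukuda1994, p. 264 (the index `n₀`)] [cite: Washington1997, §13.1 Lemma 13.3 and Prop. 13.2] -/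
theorem forall_totallyRamifiedFrom_zero_h261648q1
    {θ : AlgebraicClosure ℚ} (hθ : aeval θ (Cubic.toPoly ⟨1, ((-1 : ℤ) : ℚ), ((-4 : ℤ) : ℚ), ((2 : ℤ) : ℚ)⟩) = 0)
    :
    haveI : FiniteDimensional ℚ (IntermediateField.adjoin ℚ {θ}) :=
      IntermediateField.adjoin.finiteDimensional ((AlgebraicClosure.isAlgebraic ℚ).isAlgebraic θ).isIntegral
    haveI : NumberField (IntermediateField.adjoin ℚ {θ}) := NumberField.mk
    ∀ κL : ZpExtension (IntermediateField.adjoin ℚ {θ}) 2, κL.IsCyclotomic → TotallyRamifiedFrom κL 0 := by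
  haveI : FiniteDimensional ℚ (IntermediateField.adjoin ℚ {θ}) :=
    IntermediateField.adjoin.finiteDimensional ((AlgebraicClosure.isAlgebraic ℚ).isAlgebraic θ).isIntegral
  haveI : NumberField (IntermediateField.adjoin ℚ {θ}) := NumberField.mk
  have hirr := irreducible_cubic_d316p
  have h3 := finrank_adjoin_eq_three_of_irreducible hirr hθ
  obtain ⟨B, -, hB⟩ := exists_ringOfIntegers_cubic_root (p := -1) (q := -4) (r := 2) hθ
  refine forall_totallyRamifiedFrom_zero_adjoin_of_evenIndexCertificate hirr hθ
    (((-2 : ℤ) : 𝓞 (IntermediateField.adjoin ℚ {θ})) + ((2 : ℤ) : 𝓞 (IntermediateField.adjoin ℚ {θ})) * B + ((0 : ℤ) : 𝓞 (IntermediateField.adjoin ℚ {θ})) * B ^ 2)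
    (((-2 : ℤ) : 𝓞 (IntermediateField.adjoin ℚ {θ})) + ((-1 : ℤ) : 𝓞 (IntermediateField.adjoin ℚ {θ})) * B + ((1 : ℤ) : 𝓞 (IntermediateField.adjoin ℚ {θ})) * B ^ 2)
    (((-2 : ℤ) : 𝓞 (IntermediateField.adjoin ℚ {θ})) + ((-1 : ℤ) : 𝓞 (IntermediateField.adjoin ℚ {θ})) * B + ((1 : ℤ) : 𝓞 (IntermediateField.adjoin ℚ {θ})) * B ^ 2)
    (((3 : ℤ) : 𝓞 (IntermediateField.adjoin ℚ {θ})) + ((-1 : ℤ) : 𝓞 (IntermediateField.adjoin ℚ {θ})) * B + ((0 : ℤ) : 𝓞 (IntermediateField.adjoin ℚ {θ})) * B ^ 2) ?_ ?_ ?_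
  · push_cast; linear_combination (((2 : ℤ) : 𝓞 (IntermediateField.adjoin ℚ {θ})) + ((-2 : ℤ) : 𝓞 (IntermediateField.adjoin ℚ {θ})) * B) * hB
  · push_cast; linear_combination (((-1 : ℤ) : 𝓞 (IntermediateField.adjoin ℚ {θ})) + ((1 : ℤ) : 𝓞 (IntermediateField.adjoin ℚ {θ})) * B) * hB
  · have hz : (2 : 𝓞 (IntermediateField.adjoin ℚ {θ})) - (((3 : ℤ) : 𝓞 (IntermediateField.adjoin ℚ {θ})) + ((-1 : ℤ) : 𝓞 (IntermediateField.adjoin ℚ {θ})) * B + ((0 : ℤ) : 𝓞 (IntermediateField.adjoin ℚ {θ})) * B ^ 2) ^ 3 =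
        ((-27 : ℤ) : 𝓞 (IntermediateField.adjoin ℚ {θ})) + (31 : ℤ) * B + (-8 : ℤ) * B ^ 2 := by
      push_cast; linear_combination (((1 : ℤ) : 𝓞 (IntermediateField.adjoin ℚ {θ}))) * hB
    rw [hz]
    exact not_eight_dvd_norm_coords _ h3 B hirr hB (-27) (31) (-8) (N := 2666)
      (by simp only [Matrix.one_fin_three, Matrix.det_fin_three, Matrix.add_apply, Matrix.smul_apply, sq, Matrix.mul_apply,
        Fin.sum_univ_three, Matrix.of_apply, Matrix.cons_val', Matrix.cons_val_zero, Matrix.cons_val_one, Matrix.cons_val_two,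
        Matrix.head_cons, Matrix.tail_cons, Matrix.empty_val', Matrix.cons_val_fin_one, smul_eq_mul]; norm_num) (by norm_num)

/-- **(A)₂ for `261648q1` from a NARROW RANK CERTIFICATE of the totally real cubic point field, NO print fact** (`d = 316`, `2 = 𝔭𝔮²`, `h = 1`; kit F3(i) ranks 0 → 1 → 1 (n₀ = 1 there)): `θ` any root of
`X³ + (-1)X² + (-4)X + (2)` (`ℚ(P) = ℚ(β) = ℚ(θ)`, `β = x(P) = 68045 + (12756)θ + (-24099)θ²` a root of the `2`-division cubic — exact change of
generator); displayed, for a layer index `n` and a bound `B`: along every cyclotomic `ℤ₂`-extension of `ℚ(θ)`, `[Cl⁺(layer n+1) : (Cl⁺)²] = [Cl⁺(layer n) : (Cl⁺)²]`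
and `ord₂ [Cl⁺(layer m) : (Cl⁺)²] ≤ B` for `m ≤ n` (narrow `2`-ranks; instrument). KERNEL: `n₀ = 0` on the cubic field (`forall_totallyRamifiedFrom_zero_h261648q1`,
monotone to `n`), cruxlead-19573-w2's NARROW FUKUDA + Kida-lite ascent `NarrowRankCert.conjA_two_cubicModel_of_narrowRankCertificate` (any sign of `Δ`).
No `hLim2` (the LIM35@2-REAL print binder of GEN 8's `conjA_two_261648q1` is not used). BSD for `261648q1` is NOT proved by this.
[cite: Fukuda1994, Thm. 1 (2), p. 264] [cite: CoatesSujatha2005, Conj. A and Thm. 3.4] [cite: Kida1982JFields, main theorem (μ-part; shape only)] -/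
theorem conjA_two_261648q1_of_narrowRankCert
    {θ : AlgebraicClosure ℚ} (hθ : aeval θ (Cubic.toPoly ⟨1, ((-1 : ℤ) : ℚ), ((-4 : ℤ) : ℚ), ((2 : ℤ) : ℚ)⟩) = 0)
    (n B : ℕ)
    (hcert : haveI : FiniteDimensional ℚ (IntermediateField.adjoin ℚ {θ}) :=
        IntermediateField.adjoin.finiteDimensional ((AlgebraicClosure.isAlgebraic ℚ).isAlgebraic θ).isIntegral
      haveI : NumberField (IntermediateField.adjoin ℚ {θ}) := NumberField.mk
      ∀ κL : ZpExtension (IntermediateField.adjoin ℚ {θ}) 2, κL.IsCyclotomic →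
        (∀ [NumberField ↥(κL.layer n)] [NumberField ↥(κL.layer (n + 1))],
          (powMonoidHom (α := NarrowClassGroup ↥(κL.layer (n + 1))) 2).range.index =
            (powMonoidHom (α := NarrowClassGroup ↥(κL.layer n)) 2).range.index) ∧
        (∀ m : ℕ, m ≤ n → ∀ [NumberField ↥(κL.layer m)],
          padicValNat 2 (powMonoidHom (α := NarrowClassGroup ↥(κL.layer m)) 2).range.index ≤ B))
    (κ : ZpExtension ℚ 2) (hκ : κ.IsCyclotomic) :
    haveI := (isElliptic_cubicModel _ _ _ (by simp only [Cubic.discr]; norm_num) : (⟨0, ((0 : ℤ) : ℚ), 0, ((-3540805887 : ℤ) : ℚ), ((-81096346959158 : ℤ) : ℚ)⟩ : WeierstrassCurve ℚ).IsElliptic)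
    ∃ (γ : absoluteGaloisGroup ℚ) (D : (⟨0, ((0 : ℤ) : ℚ), 0, ((-3540805887 : ℤ) : ℚ), ((-81096346959158 : ℤ) : ℚ)⟩ : WeierstrassCurve ℚ).FineSelmerDualData κ γ),
      Module.Finite ℤ_[2] (RestrictScalars ℤ_[2] (IwasawaAlgebra 2) D.X) := by
  haveI := (isElliptic_cubicModel _ _ _ (by simp only [Cubic.discr]; norm_num) : (⟨0, ((0 : ℤ) : ℚ), 0, ((-3540805887 : ℤ) : ℚ), ((-81096346959158 : ℤ) : ℚ)⟩ : WeierstrassCurve ℚ).IsElliptic)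
  have hθ' : θ ^ 3 + (-1 : AlgebraicClosure ℚ) * θ ^ 2 + (-4 : AlgebraicClosure ℚ) * θ + (2 : AlgebraicClosure ℚ) = 0 := by
    have := hθ
    simp only [Cubic.toPoly, map_one, one_mul, aeval_add, aeval_mul, aeval_C, aeval_X_pow, aeval_X,
      eq_ratCast, Rat.cast_intCast] at this
    push_cast at this
    linear_combination this
  obtain ⟨β, hβdef⟩ : ∃ β : AlgebraicClosure ℚ, β = algebraMap ℚ (AlgebraicClosure ℚ) (68045 : ℚ) +
      algebraMap ℚ (AlgebraicClosure ℚ) (12756 : ℚ) * θ + algebraMap ℚ (AlgebraicClosure ℚ) (-24099 : ℚ) * θ ^ 2 := ⟨_, rfl⟩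
  have hβ : aeval β (Cubic.toPoly ⟨1, ((0 : ℤ) : ℚ), ((-3540805887 : ℤ) : ℚ), ((-81096346959158 : ℤ) : ℚ)⟩) = 0 := by
    simp only [Cubic.toPoly, map_one, one_mul, aeval_add, aeval_mul, aeval_C, aeval_X_pow, aeval_X, eq_ratCast,
      Rat.cast_intCast]
    rw [hβdef]
    simp only [eq_ratCast]
    push_cast
    linear_combination ((-3486915174474 : AlgebraicClosure ℚ) + (59035664530116 : AlgebraicClosure ℚ) * θ + (8228813958369 : AlgebraicClosure ℚ) * θ ^ 2 + (-13995778642299 : AlgebraicClosure ℚ) * θ ^ 3) * hθ'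
  have hadj : IntermediateField.adjoin ℚ {β} = IntermediateField.adjoin ℚ {θ} := by
    apply le_antisymm
    · rw [IntermediateField.adjoin_simple_le_iff, hβdef]
      have hθmem := IntermediateField.mem_adjoin_simple_self ℚ θ
      exact add_mem (add_mem (algebraMap_mem _ _) (mul_mem (algebraMap_mem _ _) hθmem))
        (mul_mem (algebraMap_mem _ _) (pow_mem hθmem 2))
    · rw [IntermediateField.adjoin_simple_le_iff]
      have hθeq : θ = algebraMap ℚ (AlgebraicClosure ℚ) (-9481097860256 / 109503 : ℚ) +
          algebraMap ℚ (AlgebraicClosure ℚ) (-275974019 / 219006 : ℚ) * β +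
          algebraMap ℚ (AlgebraicClosure ℚ) (8033 / 219006 : ℚ) * β ^ 2 := by
        rw [hβdef]; simp only [eq_ratCast]; push_cast
        linear_combination (((30393200919 : AlgebraicClosure ℚ) / 24334) + ((-518362171937 : AlgebraicClosure ℚ) / 24334) * θ) * hθ'
      rw [hθeq]
      have hβmem := IntermediateField.mem_adjoin_simple_self ℚ β
      exact add_mem (add_mem (algebraMap_mem _ _) (mul_mem (algebraMap_mem _ _) hβmem))
        (mul_mem (algebraMap_mem _ _) (pow_mem hβmem 2))
  haveI : FiniteDimensional ℚ (IntermediateField.adjoin ℚ {θ}) :=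
    IntermediateField.adjoin.finiteDimensional ((AlgebraicClosure.isAlgebraic ℚ).isAlgebraic θ).isIntegral
  haveI : NumberField (IntermediateField.adjoin ℚ {θ}) := NumberField.mk
  have h3 := finrank_adjoin_eq_three_of_irreducible irreducible_cubic_d316p hθ
  have h3β : Module.finrank ℚ (IntermediateField.adjoin ℚ {β}) = 3 := by rw [hadj]; exact h3
  -- transport along `ℚ(β) = ℚ(θ)` by substituting a field VARIABLE (a `rw` on this statement times out at `whnf`)
  have hcert' : ∀ F : IntermediateField ℚ (AlgebraicClosure ℚ), IntermediateField.adjoin ℚ {θ} = F →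
      ∀ κL : ZpExtension ↥F 2, κL.IsCyclotomic →
      TotallyRamifiedFrom κL n ∧
      (∀ [NumberField ↥(κL.layer n)] [NumberField ↥(κL.layer (n + 1))],
        (powMonoidHom (α := NarrowClassGroup ↥(κL.layer (n + 1))) 2).range.index =
          (powMonoidHom (α := NarrowClassGroup ↥(κL.layer n)) 2).range.index) ∧
      (∀ m : ℕ, m ≤ n → ∀ [NumberField ↥(κL.layer m)],
        padicValNat 2 (powMonoidHom (α := NarrowClassGroup ↥(κL.layer m)) 2).range.index ≤ B) :=
    by rintro F rfl; exact fun κL hκL => ⟨(forall_totallyRamifiedFrom_zero_h261648q1 hθ κL hκL).mono (Nat.zero_le n), hcert κL hκL⟩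
  exact NarrowRankCert.conjA_two_cubicModel_of_narrowRankCertificate (0) (-3540805887) (-81096346959158)
    (irreducibleCubic_of_finrank_three_srnrA hβ h3β) hβ n B (hcert' _ hadj.symm) κ hκ

/-- **(A)₂ for `261648q1` WITHOUT any print fact — the CENSUS INSTANCE: ONE displayed equality of narrow `2`-ranks at layers `0 / 1`**, i.e.
`rank₂ Cl⁺(ℚ(θ)·ℚ₁) = rank₂ Cl⁺(ℚ(θ))` (`ℚ(θ)·ℚ₁ = ℚ(θ, √2)`, degrees `6` and `3`; for these `h`-odd fields = equality of the unit-signature defects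
`#(U⁺/U²)` at the two layers) — instrument tier, **UNVALUED at landing time** (no `bnfnarrow` record in the cell for this field; kit owed). `n = 0`, `B = ord₂ [Cl⁺(ℚ(θ)) : (Cl⁺)²]`
in `conjA_two_261648q1_of_narrowRankCert` (the layer-`0` bound is automatic by `index_range_pow_narrowClassGroup_layer_zero_eq`). Replaces the print binder `hLim2`
(LIM35@2-REAL) of GEN 8's road on this row. BSD for `261648q1` is NOT proved by this. [cite: Fukuda1994, Thm. 1 (2), p. 264] [cite: Washington1997, §13.1]
[cite: CoatesSujatha2005, Conj. A and Thm. 3.4] -/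
theorem conjA_two_261648q1_of_narrowRankEq₀₁
    {θ : AlgebraicClosure ℚ} (hθ : aeval θ (Cubic.toPoly ⟨1, ((-1 : ℤ) : ℚ), ((-4 : ℤ) : ℚ), ((2 : ℤ) : ℚ)⟩) = 0)
    (hnr : haveI : FiniteDimensional ℚ (IntermediateField.adjoin ℚ {θ}) :=
        IntermediateField.adjoin.finiteDimensional ((AlgebraicClosure.isAlgebraic ℚ).isAlgebraic θ).isIntegral
      haveI : NumberField (IntermediateField.adjoin ℚ {θ}) := NumberField.mk
      ∀ κL : ZpExtension (IntermediateField.adjoin ℚ {θ}) 2, κL.IsCyclotomic →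
        ∀ [NumberField ↥(κL.layer 0)] [NumberField ↥(κL.layer 1)],
          (powMonoidHom (α := NarrowClassGroup ↥(κL.layer 1)) 2).range.index =
            (powMonoidHom (α := NarrowClassGroup ↥(κL.layer 0)) 2).range.index)
    (κ : ZpExtension ℚ 2) (hκ : κ.IsCyclotomic) :
    haveI := (isElliptic_cubicModel _ _ _ (by simp only [Cubic.discr]; norm_num) : (⟨0, ((0 : ℤ) : ℚ), 0, ((-3540805887 : ℤ) : ℚ), ((-81096346959158 : ℤ) : ℚ)⟩ : WeierstrassCurve ℚ).IsElliptic)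
    ∃ (γ : absoluteGaloisGroup ℚ) (D : (⟨0, ((0 : ℤ) : ℚ), 0, ((-3540805887 : ℤ) : ℚ), ((-81096346959158 : ℤ) : ℚ)⟩ : WeierstrassCurve ℚ).FineSelmerDualData κ γ),
      Module.Finite ℤ_[2] (RestrictScalars ℤ_[2] (IwasawaAlgebra 2) D.X) := by
  haveI : FiniteDimensional ℚ (IntermediateField.adjoin ℚ {θ}) :=
    IntermediateField.adjoin.finiteDimensional ((AlgebraicClosure.isAlgebraic ℚ).isAlgebraic θ).isIntegral
  haveI : NumberField (IntermediateField.adjoin ℚ {θ}) := NumberField.mk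
  exact conjA_two_261648q1_of_narrowRankCert hθ 0 _
    (narrowRankCert_zero_of_layerEq_A _ hnr) κ hκ

/-- **`n₀ = 0` for `ℚ(θ)` of `279440c1`, KERNEL, by an EVEN-INDEX CERTIFICATE** (k4-w1 p689647 `totallyRamifiedFrom_zero_of_evenIndexCertificate`):
`u = [-2, 0, 2]`, `v = [-2, -3, -1]`, `m = [-176, -61, 7]`, `m' = [-12687, -2039, 1108]` (coordinates in `ℤ[θ]`, index `1` — `2`-maximal) satisfy `u² − 2v² = 4m`, `m² = 2m'`
and `N(2 − m'³) = -7289544166335255728511490352255350` (`ord₂ = 1`, so `8 ∤`) — exact search (seat tools), verified as ring identities + one companion determinant.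
[cite: Fukuda1994, p. 264 (the index `n₀`)] [cite: Washington1997, §13.1 Lemma 13.3 and Prop. 13.2] -/
theorem forall_totallyRamifiedFrom_zero_h279440c1
    {θ : AlgebraicClosure ℚ} (hθ : aeval θ (Cubic.toPoly ⟨1, ((-1 : ℤ) : ℚ), ((-36 : ℤ) : ℚ), ((-70 : ℤ) : ℚ)⟩) = 0)
    :
    haveI : FiniteDimensional ℚ (IntermediateField.adjoin ℚ {θ}) :=
      IntermediateField.adjoin.finiteDimensional ((AlgebraicClosure.isAlgebraic ℚ).isAlgebraic θ).isIntegral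
    haveI : NumberField (IntermediateField.adjoin ℚ {θ}) := NumberField.mk
    ∀ κL : ZpExtension (IntermediateField.adjoin ℚ {θ}) 2, κL.IsCyclotomic → TotallyRamifiedFrom κL 0 := by
  haveI : FiniteDimensional ℚ (IntermediateField.adjoin ℚ {θ}) :=
    IntermediateField.adjoin.finiteDimensional ((AlgebraicClosure.isAlgebraic ℚ).isAlgebraic θ).isIntegral
  haveI : NumberField (IntermediateField.adjoin ℚ {θ}) := NumberField.mk
  have hirr := irreducible_cubic_d9980p
  have h3 := finrank_adjoin_eq_three_of_irreducible hirr hθ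
  obtain ⟨B, -, hB⟩ := exists_ringOfIntegers_cubic_root (p := -1) (q := -36) (r := -70) hθ
  refine forall_totallyRamifiedFrom_zero_adjoin_of_evenIndexCertificate hirr hθ
    (((-2 : ℤ) : 𝓞 (IntermediateField.adjoin ℚ {θ})) + ((0 : ℤ) : 𝓞 (IntermediateField.adjoin ℚ {θ})) * B + ((2 : ℤ) : 𝓞 (IntermediateField.adjoin ℚ {θ})) * B ^ 2)
    (((-2 : ℤ) : 𝓞 (IntermediateField.adjoin ℚ {θ})) + ((-3 : ℤ) : 𝓞 (IntermediateField.adjoin ℚ {θ})) * B + ((-1 : ℤ) : 𝓞 (IntermediateField.adjoin ℚ {θ})) * B ^ 2)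
    (((-176 : ℤ) : 𝓞 (IntermediateField.adjoin ℚ {θ})) + ((-61 : ℤ) : 𝓞 (IntermediateField.adjoin ℚ {θ})) * B + ((7 : ℤ) : 𝓞 (IntermediateField.adjoin ℚ {θ})) * B ^ 2)
    (((-12687 : ℤ) : 𝓞 (IntermediateField.adjoin ℚ {θ})) + ((-2039 : ℤ) : 𝓞 (IntermediateField.adjoin ℚ {θ})) * B + ((1108 : ℤ) : 𝓞 (IntermediateField.adjoin ℚ {θ})) * B ^ 2) ?_ ?_ ?_
  · push_cast; linear_combination (((-10 : ℤ) : 𝓞 (IntermediateField.adjoin ℚ {θ})) + ((2 : ℤ) : 𝓞 (IntermediateField.adjoin ℚ {θ})) * B) * hB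
  · push_cast; linear_combination (((-805 : ℤ) : 𝓞 (IntermediateField.adjoin ℚ {θ})) + ((49 : ℤ) : 𝓞 (IntermediateField.adjoin ℚ {θ})) * B) * hB
  · have hz : (2 : 𝓞 (IntermediateField.adjoin ℚ {θ})) - (((-12687 : ℤ) : 𝓞 (IntermediateField.adjoin ℚ {θ})) + ((-2039 : ℤ) : 𝓞 (IntermediateField.adjoin ℚ {θ})) * B + ((1108 : ℤ) : 𝓞 (IntermediateField.adjoin ℚ {θ})) * B ^ 2) ^ 3 =
        ((-1265545087645 : ℤ) : 𝓞 (IntermediateField.adjoin ℚ {θ})) + (-1410404143927 : ℤ) * B + (-350461988476 : ℤ) * B ^ 2 := by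
      push_cast; linear_combination (((-47252060205 : ℤ) : 𝓞 (IntermediateField.adjoin ℚ {θ})) + ((-9913172956 : ℤ) : 𝓞 (IntermediateField.adjoin ℚ {θ})) * B + ((6149368976 : ℤ) : 𝓞 (IntermediateField.adjoin ℚ {θ})) * B ^ 2 + ((-1360251712 : ℤ) : 𝓞 (IntermediateField.adjoin ℚ {θ})) * B ^ 3) * hB
    rw [hz]
    exact not_eight_dvd_norm_coords _ h3 B hirr hB (-1265545087645) (-1410404143927) (-350461988476) (N := -7289544166335255728511490352255350)
      (by simp only [Matrix.one_fin_three, Matrix.det_fin_three, Matrix.add_apply, Matrix.smul_apply, sq, Matrix.mul_apply,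
        Fin.sum_univ_three, Matrix.of_apply, Matrix.cons_val', Matrix.cons_val_zero, Matrix.cons_val_one, Matrix.cons_val_two,
        Matrix.head_cons, Matrix.tail_cons, Matrix.empty_val', Matrix.cons_val_fin_one, smul_eq_mul]; norm_num) (by norm_num)

/-- **(A)₂ for `279440c1` from a NARROW RANK CERTIFICATE of the totally real cubic point field, NO print fact** (`d = 9980`, `2 = 𝔭²𝔮`, `h = 1`; real cubic tower 2-trivial at layers 2, 3 (kit j301920 `cyc [] []`)): `θ` any root of
`X³ + (-1)X² + (-36)X + (-70)` (`ℚ(P) = ℚ(β) = ℚ(θ)`, `β = x(P) = 1470966 + (233916)θ + (-63655)θ²` a root of the `2`-division cubic — exact change of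
generator); displayed, for a layer index `n` and a bound `B`: along every cyclotomic `ℤ₂`-extension of `ℚ(θ)`, `[Cl⁺(layer n+1) : (Cl⁺)²] = [Cl⁺(layer n) : (Cl⁺)²]`
and `ord₂ [Cl⁺(layer m) : (Cl⁺)²] ≤ B` for `m ≤ n` (narrow `2`-ranks; instrument). KERNEL: `n₀ = 0` on the cubic field (`forall_totallyRamifiedFrom_zero_h279440c1`,
monotone to `n`), cruxlead-19573-w2's NARROW FUKUDA + Kida-lite ascent `NarrowRankCert.conjA_two_cubicModel_of_narrowRankCertificate` (any sign of `Δ`).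
No `hLim2` (the LIM35@2-REAL print binder of GEN 8's `conjA_two_279440c1` is not used). BSD for `279440c1` is NOT proved by this.
[cite: Fukuda1994, Thm. 1 (2), p. 264] [cite: CoatesSujatha2005, Conj. A and Thm. 3.4] [cite: Kida1982JFields, main theorem (μ-part; shape only)] -/
theorem conjA_two_279440c1_of_narrowRankCert
    {θ : AlgebraicClosure ℚ} (hθ : aeval θ (Cubic.toPoly ⟨1, ((-1 : ℤ) : ℚ), ((-36 : ℤ) : ℚ), ((-70 : ℤ) : ℚ)⟩) = 0)
    (n B : ℕ)
    (hcert : haveI : FiniteDimensional ℚ (IntermediateField.adjoin ℚ {θ}) :=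
        IntermediateField.adjoin.finiteDimensional ((AlgebraicClosure.isAlgebraic ℚ).isAlgebraic θ).isIntegral
      haveI : NumberField (IntermediateField.adjoin ℚ {θ}) := NumberField.mk
      ∀ κL : ZpExtension (IntermediateField.adjoin ℚ {θ}) 2, κL.IsCyclotomic →
        (∀ [NumberField ↥(κL.layer n)] [NumberField ↥(κL.layer (n + 1))],
          (powMonoidHom (α := NarrowClassGroup ↥(κL.layer (n + 1))) 2).range.index =
            (powMonoidHom (α := NarrowClassGroup ↥(κL.layer n)) 2).range.index) ∧
        (∀ m : ℕ, m ≤ n → ∀ [NumberField ↥(κL.layer m)],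
          padicValNat 2 (powMonoidHom (α := NarrowClassGroup ↥(κL.layer m)) 2).range.index ≤ B))
    (κ : ZpExtension ℚ 2) (hκ : κ.IsCyclotomic) :
    haveI := (isElliptic_cubicModel _ _ _ (by simp only [Cubic.discr]; norm_num) : (⟨0, ((1 : ℤ) : ℚ), 0, ((-114041197436 : ℤ) : ℚ), ((-14823196533966296 : ℤ) : ℚ)⟩ : WeierstrassCurve ℚ).IsElliptic)
    ∃ (γ : absoluteGaloisGroup ℚ) (D : (⟨0, ((1 : ℤ) : ℚ), 0, ((-114041197436 : ℤ) : ℚ), ((-14823196533966296 : ℤ) : ℚ)⟩ : WeierstrassCurve ℚ).FineSelmerDualData κ γ),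
      Module.Finite ℤ_[2] (RestrictScalars ℤ_[2] (IwasawaAlgebra 2) D.X) := by
  haveI := (isElliptic_cubicModel _ _ _ (by simp only [Cubic.discr]; norm_num) : (⟨0, ((1 : ℤ) : ℚ), 0, ((-114041197436 : ℤ) : ℚ), ((-14823196533966296 : ℤ) : ℚ)⟩ : WeierstrassCurve ℚ).IsElliptic)
  have hθ' : θ ^ 3 + (-1 : AlgebraicClosure ℚ) * θ ^ 2 + (-36 : AlgebraicClosure ℚ) * θ + (-70 : AlgebraicClosure ℚ) = 0 := by
    have := hθ
    simp only [Cubic.toPoly, map_one, one_mul, aeval_add, aeval_mul, aeval_C, aeval_X_pow, aeval_X,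
      eq_ratCast, Rat.cast_intCast] at this
    push_cast at this
    linear_combination this
  obtain ⟨β, hβdef⟩ : ∃ β : AlgebraicClosure ℚ, β = algebraMap ℚ (AlgebraicClosure ℚ) (1470966 : ℚ) +
      algebraMap ℚ (AlgebraicClosure ℚ) (233916 : ℚ) * θ + algebraMap ℚ (AlgebraicClosure ℚ) (-63655 : ℚ) * θ ^ 2 := ⟨_, rfl⟩
  have hβ : aeval β (Cubic.toPoly ⟨1, ((1 : ℤ) : ℚ), ((-114041197436 : ℤ) : ℚ), ((-14823196533966296 : ℤ) : ℚ)⟩) = 0 := by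
    simp only [Cubic.toPoly, map_one, one_mul, aeval_add, aeval_mul, aeval_C, aeval_X_pow, aeval_X, eq_ratCast,
      Rat.cast_intCast]
    rw [hβdef]
    simp only [eq_ratCast]
    push_cast
    linear_combination ((-42860252107125034 : AlgebraicClosure ℚ) + (732050685724260 : AlgebraicClosure ℚ) * θ + (2585526690139325 : AlgebraicClosure ℚ) * θ ^ 2 + (-257927451736375 : AlgebraicClosure ℚ) * θ ^ 3) * hθ'
  have hadj : IntermediateField.adjoin ℚ {β} = IntermediateField.adjoin ℚ {θ} := by
    apply le_antisymm
    · rw [IntermediateField.adjoin_simple_le_iff, hβdef]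
      have hθmem := IntermediateField.mem_adjoin_simple_self ℚ θ
      exact add_mem (add_mem (algebraMap_mem _ _) (mul_mem (algebraMap_mem _ _) hθmem))
        (mul_mem (algebraMap_mem _ _) (pow_mem hθmem 2))
    · rw [IntermediateField.adjoin_simple_le_iff]
      have hθeq : θ = algebraMap ℚ (AlgebraicClosure ℚ) (49383642969422 / 1977326743 : ℚ) +
          algebraMap ℚ (AlgebraicClosure ℚ) (12409348439 / 193778020814 : ℚ) * β +
          algebraMap ℚ (AlgebraicClosure ℚ) (-63655 / 193778020814 : ℚ) * β ^ 2 := by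
        rw [hβdef]; simp only [eq_ratCast]; push_cast
        linear_combination (((-1637708642847425 : AlgebraicClosure ℚ) / 193778020814) + ((257927451736375 : AlgebraicClosure ℚ) / 193778020814) * θ) * hθ'
      rw [hθeq]
      have hβmem := IntermediateField.mem_adjoin_simple_self ℚ β
      exact add_mem (add_mem (algebraMap_mem _ _) (mul_mem (algebraMap_mem _ _) hβmem))
        (mul_mem (algebraMap_mem _ _) (pow_mem hβmem 2))
  haveI : FiniteDimensional ℚ (IntermediateField.adjoin ℚ {θ}) :=
    IntermediateField.adjoin.finiteDimensional ((AlgebraicClosure.isAlgebraic ℚ).isAlgebraic θ).isIntegral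
  haveI : NumberField (IntermediateField.adjoin ℚ {θ}) := NumberField.mk
  have h3 := finrank_adjoin_eq_three_of_irreducible irreducible_cubic_d9980p hθ
  have h3β : Module.finrank ℚ (IntermediateField.adjoin ℚ {β}) = 3 := by rw [hadj]; exact h3
  -- transport along `ℚ(β) = ℚ(θ)` by substituting a field VARIABLE (a `rw` on this statement times out at `whnf`)
  have hcert' : ∀ F : IntermediateField ℚ (AlgebraicClosure ℚ), IntermediateField.adjoin ℚ {θ} = F →
      ∀ κL : ZpExtension ↥F 2, κL.IsCyclotomic →
      TotallyRamifiedFrom κL n ∧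
      (∀ [NumberField ↥(κL.layer n)] [NumberField ↥(κL.layer (n + 1))],
        (powMonoidHom (α := NarrowClassGroup ↥(κL.layer (n + 1))) 2).range.index =
          (powMonoidHom (α := NarrowClassGroup ↥(κL.layer n)) 2).range.index) ∧
      (∀ m : ℕ, m ≤ n → ∀ [NumberField ↥(κL.layer m)],
        padicValNat 2 (powMonoidHom (α := NarrowClassGroup ↥(κL.layer m)) 2).range.index ≤ B) :=
    by rintro F rfl; exact fun κL hκL => ⟨(forall_totallyRamifiedFrom_zero_h279440c1 hθ κL hκL).mono (Nat.zero_le n), hcert κL hκL⟩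
  exact NarrowRankCert.conjA_two_cubicModel_of_narrowRankCertificate (1) (-114041197436) (-14823196533966296)
    (irreducibleCubic_of_finrank_three_srnrA hβ h3β) hβ n B (hcert' _ hadj.symm) κ hκ

/-- **(A)₂ for `279440c1` WITHOUT any print fact — the CENSUS INSTANCE: ONE displayed equality of narrow `2`-ranks at layers `0 / 1`**, i.e.
`rank₂ Cl⁺(ℚ(θ)·ℚ₁) = rank₂ Cl⁺(ℚ(θ))` (`ℚ(θ)·ℚ₁ = ℚ(θ, √2)`, degrees `6` and `3`; for these `h`-odd fields = equality of the unit-signature defects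
`#(U⁺/U²)` at the two layers) — instrument tier, **UNVALUED at landing time** (no `bnfnarrow` record in the cell for this field; kit owed). `n = 0`, `B = ord₂ [Cl⁺(ℚ(θ)) : (Cl⁺)²]`
in `conjA_two_279440c1_of_narrowRankCert` (the layer-`0` bound is automatic by `index_range_pow_narrowClassGroup_layer_zero_eq`). Replaces the print binder `hLim2`
(LIM35@2-REAL) of GEN 8's road on this row. BSD for `279440c1` is NOT proved by this. [cite: Fukuda1994, Thm. 1 (2), p. 264] [cite: Washington1997, §13.1]
[cite: CoatesSujatha2005, Conj. A and Thm. 3.4] -/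
theorem conjA_two_279440c1_of_narrowRankEq₀₁
    {θ : AlgebraicClosure ℚ} (hθ : aeval θ (Cubic.toPoly ⟨1, ((-1 : ℤ) : ℚ), ((-36 : ℤ) : ℚ), ((-70 : ℤ) : ℚ)⟩) = 0)
    (hnr : haveI : FiniteDimensional ℚ (IntermediateField.adjoin ℚ {θ}) :=
        IntermediateField.adjoin.finiteDimensional ((AlgebraicClosure.isAlgebraic ℚ).isAlgebraic θ).isIntegral
      haveI : NumberField (IntermediateField.adjoin ℚ {θ}) := NumberField.mk
      ∀ κL : ZpExtension (IntermediateField.adjoin ℚ {θ}) 2, κL.IsCyclotomic →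
        ∀ [NumberField ↥(κL.layer 0)] [NumberField ↥(κL.layer 1)],
          (powMonoidHom (α := NarrowClassGroup ↥(κL.layer 1)) 2).range.index =
            (powMonoidHom (α := NarrowClassGroup ↥(κL.layer 0)) 2).range.index)
    (κ : ZpExtension ℚ 2) (hκ : κ.IsCyclotomic) :
    haveI := (isElliptic_cubicModel _ _ _ (by simp only [Cubic.discr]; norm_num) : (⟨0, ((1 : ℤ) : ℚ), 0, ((-114041197436 : ℤ) : ℚ), ((-14823196533966296 : ℤ) : ℚ)⟩ : WeierstrassCurve ℚ).IsElliptic)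
    ∃ (γ : absoluteGaloisGroup ℚ) (D : (⟨0, ((1 : ℤ) : ℚ), 0, ((-114041197436 : ℤ) : ℚ), ((-14823196533966296 : ℤ) : ℚ)⟩ : WeierstrassCurve ℚ).FineSelmerDualData κ γ),
      Module.Finite ℤ_[2] (RestrictScalars ℤ_[2] (IwasawaAlgebra 2) D.X) := by
  haveI : FiniteDimensional ℚ (IntermediateField.adjoin ℚ {θ}) :=
    IntermediateField.adjoin.finiteDimensional ((AlgebraicClosure.isAlgebraic ℚ).isAlgebraic θ).isIntegral
  haveI : NumberField (IntermediateField.adjoin ℚ {θ}) := NumberField.mk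
  exact conjA_two_279440c1_of_narrowRankCert hθ 0 _
    (narrowRankCert_zero_of_layerEq_A _ hnr) κ hκ

end Summit.BirchSwinnertonDyer.BirchSwinnertonDyer.Theorems.AddKatoTwo

end
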